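import Literature.Analysis.FluidPDE.KNSSMildDecayHorizontal
import HarnessLib

/-!
# Far-field bound for the Oseen–Duhamel term from a Morrey bound

Analysis/FluidPDE support file (everything proved; no definitions, no named facts).

Let `K(σ, z)[a, b]` be the Oseen–Koch–Tataru kernel (`oseenKernel`) in dimension three, with the
bound `‖K(σ, z)[a, b]‖ ≤ C₀ (σ + ‖z‖²)^{-2} ‖a‖ ‖b‖` (Koch–Nadirashvili–Seregin–Šverák 2009, (3.8);
Koch–Tataru 2001, (14); `exists_norm_oseenKernel_three_le`). Let `M(τ, ·)`, `τ ∈ (s, t)`, be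
fields obeying the scale-invariant Morrey bound `∫_{B_r(x)} ‖M(τ, y)‖² dy ≤ I r` on the balls
centred at a point `x`. Then the part of the Duhamel term `∫_{(s,t)} ∫ K(t-τ, x-y)[M, M] dy dτ`
that is **radiated to `x` from sources at distance `≥ a` from `x`** obeys

  `‖∫_{(s,t)} ∫_{‖y-x‖ ≥ a} K(t-τ, x-y)[M(τ,y), M(τ,y)] dy dτ‖ ≤ 4 C₀ I / a`,

uniformly in `s < t` (`exists_norm_setIntegral_farField_oseenKernel_le`, `∫⁻`-Morrey form, and
`exists_norm_setIntegral_farField_oseenKernel_le_of_integral`, Bochner-Morrey form). This is the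
standard dyadic computation behind the `C/|x|` decay of scale-invariant (e.g. `-1`-homogeneous or
Type-I ancient) mild solutions (KNSS 2009, (1.6); Lemarié-Rieusset 2016, ch. 4): on the shell
`A_k = {a 2^k ≤ ‖y - x‖ < a 2^{k+1}}` the kernel is at most `C₀ ((t-τ) + a² 4^k)^{-2}`, the shell
carries `∫_{A_k} ‖M‖² ≤ I a 2^{k+1}`, and `∫_{(s,t)} ((t-τ) + ρ)^{-2} dτ ≤ ρ^{-1}`; so shell `k`
contributes `≤ 2 C₀ I 2^{-k} / a` and the shells sum to `4 C₀ I / a`.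

Design: the upper bound is proved through `‖∫ f‖ₑ ≤ ∫⁻ ‖f‖ₑ` (twice), so **no measurability or
integrability of `M` is assumed** in the `∫⁻` form (if the iterated Bochner integral diverges,
Lean's `∫` is `0` and the bound is trivial); the Bochner form only needs `‖M(τ, ·)‖²` integrable
on the balls `B_r(x)` to identify the two Morrey hypotheses. Deliberately NOT here: the near-field
part (which needs pointwise information on `M`), and any statement about solutions of an equation.

## Mathlib / tree search

Tree: `exists_norm_oseenKernel_three_le` (`KNSSMildDecayHorizontal`), `integral_Ioi_add_rpow`
(`KochTataruKernel`), `setLIntegral_Ioo_sub_rpow_neg_half_of_lt` (`NSBoundedMildOseenDuhamel`,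
the reflection pattern). Mathlib: `enorm_integral_le_lintegral_enorm`, `lintegral_iUnion_le`,
`lintegral_tsum`, `exists_nat_pow_near`, `ENNReal.ofReal_tsum_of_nonneg`, `tsum_geometric_two`,
`ofReal_integral_eq_lintegral_ofReal`.

## References

* G. Koch, N. Nadirashvili, G. Seregin, V. Šverák, *Liouville theorems for the Navier–Stokes
  equations and applications*, Acta Math. 203 (2009) = arXiv:0709.3599, §3 (3.8), (1.6).
  [KochNadirashviliSereginSverak2009]
* H. Koch, D. Tataru, *Well-posedness for the Navier–Stokes equations*, Adv. Math. 157 (2001),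
  (14). [KochTataruAdvMath2001]
* P. G. Lemarié-Rieusset, *The Navier–Stokes problem in the 21st century*, CRC 2016, ch. 4.
  [LemarieRieusset2016]
-/

noncomputable section

open MeasureTheory Set Function Filter Metric
open _root_.Topology
open scoped NNReal ENNReal

namespace Literature.Analysis.FluidPDE

/-! ### Two elementary estimates -/

/-- The time integral of the parabolic weight: `∫⁻_{(s,t)} ((t - τ) + ρ)^{-2} dτ ≤ ρ^{-1}` for
`ρ > 0` (reflect `τ ↦ t - τ` onto `(0, ∞)`, where `∫_0^∞ (θ + ρ)^{-2} dθ = ρ^{-1}`). [folklore] -/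
theorem setLIntegral_Ioo_sub_add_rpow_neg_two_le (s t : ℝ) {ρ : ℝ} (hρ : 0 < ρ) :
    ∫⁻ τ in Ioo s t, ENNReal.ofReal (((t - τ) + ρ) ^ (-(2 : ℝ))) ≤ ENNReal.ofReal ρ⁻¹ := by
  have hmp : MeasurePreserving (fun τ : ℝ => t - τ) volume volume :=
    Measure.measurePreserving_sub_left volume t
  have hemb : MeasurableEmbedding (fun τ : ℝ => t - τ) :=
    (MeasurableEquiv.subLeft t).measurableEmbedding
  have h := hmp.setLIntegral_comp_preimage_emb hemb
    (fun θ => ENNReal.ofReal ((θ + ρ) ^ (-(2 : ℝ)))) (Ioi 0)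
  rw [preimage_const_sub_Ioi, sub_zero] at h
  obtain ⟨hint, hval⟩ := integral_Ioi_add_rpow (a := -(2 : ℝ)) (τ := 0) (ρ := ρ) (by norm_num)
    (by rwa [zero_add])
  calc ∫⁻ τ in Ioo s t, ENNReal.ofReal (((t - τ) + ρ) ^ (-(2 : ℝ)))
      ≤ ∫⁻ τ in Iio t, ENNReal.ofReal (((t - τ) + ρ) ^ (-(2 : ℝ))) :=
        lintegral_mono_set Ioo_subset_Iio_self
    _ = ∫⁻ θ in Ioi 0, ENNReal.ofReal ((θ + ρ) ^ (-(2 : ℝ))) := h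
    _ = ENNReal.ofReal (∫ θ in Ioi 0, (θ + ρ) ^ (-(2 : ℝ))) := by
        rw [ofReal_integral_eq_lintegral_ofReal hint]
        exact (ae_restrict_iff' measurableSet_Ioi).2
          (Eventually.of_forall fun θ hθ => Real.rpow_nonneg (by linarith [mem_Ioi.1 hθ]) _)
    _ = ENNReal.ofReal ρ⁻¹ := by
        rw [hval, zero_add]
        norm_num [Real.rpow_neg_one]

/-- **Dyadic-shell bound for one time slice.** If `‖K(σ, z)[a, b]‖ ≤ C₀ (σ + ‖z‖²)^{-2} ‖a‖ ‖b‖`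
(`σ > 0`) and a field `v` obeys `∫⁻_{B_r(x)} ‖v‖² ≤ I r` for all `r > 0`, then for `a > 0`
`∫⁻_{‖y-x‖ ≥ a} ‖K(σ, x-y)[v(y), v(y)]‖ dy ≤ Σ_k C₀ I a 2^{k+1} (σ + (a 2^k)²)^{-2}`: cover
`{‖y - x‖ ≥ a}` by the shells `a 2^k ≤ ‖y - x‖ < a 2^{k+1}`, on which the weight is at most
`(σ + (a 2^k)²)^{-2}` and whose `‖v‖²`-mass is at most that of `B_{a 2^{k+1}}(x)`. [folklore] -/
theorem lintegral_farField_enorm_oseenKernel_le {C₀ : ℝ} (hC₀ : 0 ≤ C₀)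
    (hK : ∀ ⦃σ : ℝ⦄, 0 < σ → ∀ z a b : EuclideanSpace ℝ (Fin 3),
      ‖oseenKernel σ z a b‖ ≤ C₀ * (σ + ‖z‖ ^ 2) ^ (-(2 : ℝ)) * ‖a‖ * ‖b‖)
    {σ I a : ℝ} (hσ : 0 < σ) (hI : 0 ≤ I) (ha : 0 < a) {x : EuclideanSpace ℝ (Fin 3)}
    {v : EuclideanSpace ℝ (Fin 3) → EuclideanSpace ℝ (Fin 3)}
    (hv : ∀ r > 0, ∫⁻ y in ball x r, ENNReal.ofReal (‖v y‖ ^ 2) ≤ ENNReal.ofReal (I * r)) :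
    ∫⁻ y in {y | a ≤ ‖y - x‖}, ‖oseenKernel σ (x - y) (v y) (v y)‖ₑ ≤
      ∑' k : ℕ, ENNReal.ofReal (C₀ * I * (a * 2 ^ (k + 1))) *
        ENNReal.ofReal ((σ + (a * 2 ^ k) ^ 2) ^ (-(2 : ℝ))) := by
  set r : ℕ → ℝ := fun k => a * 2 ^ k with hr
  have hr0 : ∀ k, 0 < r k := fun k => by positivity
  -- the dyadic shells around `x`
  set A : ℕ → Set (EuclideanSpace ℝ (Fin 3)) :=
    fun k => {y | r k ≤ ‖y - x‖ ∧ ‖y - x‖ < r (k + 1)} with hA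
  have hc : Continuous fun y : EuclideanSpace ℝ (Fin 3) => ‖y - x‖ := by fun_prop
  have hAm : ∀ k, MeasurableSet (A k) := fun k =>
    (isClosed_le continuous_const hc).measurableSet.inter
      (isOpen_lt hc continuous_const).measurableSet
  have hcover : {y : EuclideanSpace ℝ (Fin 3) | a ≤ ‖y - x‖} ⊆ ⋃ k, A k := by
    intro y hy
    have hy1 : 1 ≤ ‖y - x‖ / a := by rw [le_div_iff₀ ha, one_mul]; exact hy
    obtain ⟨n, hn1, hn2⟩ := exists_nat_pow_near hy1 one_lt_two
    refine mem_iUnion.2 ⟨n, ?_, ?_⟩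
    · show a * 2 ^ n ≤ ‖y - x‖
      rw [mul_comm, ← le_div_iff₀ ha]; exact hn1
    · show ‖y - x‖ < a * 2 ^ (n + 1)
      rw [mul_comm, ← div_lt_iff₀ ha]; exact hn2
  have hAball : ∀ k, A k ⊆ ball x (r (k + 1)) := fun k y hy => by
    rw [mem_ball, dist_eq_norm]; exact hy.2
  -- pointwise bound on the `k`-th shell
  have hpt : ∀ k, ∀ y ∈ A k, ‖oseenKernel σ (x - y) (v y) (v y)‖ₑ ≤
      ENNReal.ofReal (C₀ * (σ + r k ^ 2) ^ (-(2 : ℝ))) * ENNReal.ofReal (‖v y‖ ^ 2) := by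
    intro k y hy
    rw [← ofReal_norm, ← ENNReal.ofReal_mul (by positivity)]
    refine ENNReal.ofReal_le_ofReal ?_
    have hxy : r k ≤ ‖x - y‖ := by rw [norm_sub_rev]; exact hy.1
    have h1 : (σ + ‖x - y‖ ^ 2) ^ (-(2 : ℝ)) ≤ (σ + r k ^ 2) ^ (-(2 : ℝ)) :=
      Real.rpow_le_rpow_of_nonpos (by positivity) (by nlinarith [hr0 k]) (by norm_num)
    calc ‖oseenKernel σ (x - y) (v y) (v y)‖
        ≤ C₀ * (σ + ‖x - y‖ ^ 2) ^ (-(2 : ℝ)) * ‖v y‖ * ‖v y‖ := hK hσ _ _ _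
      _ ≤ C₀ * (σ + r k ^ 2) ^ (-(2 : ℝ)) * ‖v y‖ * ‖v y‖ := by gcongr
      _ = C₀ * (σ + r k ^ 2) ^ (-(2 : ℝ)) * ‖v y‖ ^ 2 := by ring
  -- the shell integrals
  have hshell : ∀ k, ∫⁻ y in A k, ‖oseenKernel σ (x - y) (v y) (v y)‖ₑ ≤
      ENNReal.ofReal (C₀ * I * r (k + 1)) * ENNReal.ofReal ((σ + r k ^ 2) ^ (-(2 : ℝ))) := by
    intro k
    calc ∫⁻ y in A k, ‖oseenKernel σ (x - y) (v y) (v y)‖ₑ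
        ≤ ∫⁻ y in A k, ENNReal.ofReal (C₀ * (σ + r k ^ 2) ^ (-(2 : ℝ))) *
            ENNReal.ofReal (‖v y‖ ^ 2) := setLIntegral_mono' (hAm k) (hpt k)
      _ = ENNReal.ofReal (C₀ * (σ + r k ^ 2) ^ (-(2 : ℝ))) *
            ∫⁻ y in A k, ENNReal.ofReal (‖v y‖ ^ 2) :=
          lintegral_const_mul' _ _ ENNReal.ofReal_ne_top
      _ ≤ ENNReal.ofReal (C₀ * (σ + r k ^ 2) ^ (-(2 : ℝ))) *
            ∫⁻ y in ball x (r (k + 1)), ENNReal.ofReal (‖v y‖ ^ 2) :=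
          mul_le_mul_right (lintegral_mono_set (hAball k)) _
      _ ≤ ENNReal.ofReal (C₀ * (σ + r k ^ 2) ^ (-(2 : ℝ))) * ENNReal.ofReal (I * r (k + 1)) :=
          mul_le_mul_right (hv _ (hr0 (k + 1))) _
      _ = ENNReal.ofReal (C₀ * I * r (k + 1)) * ENNReal.ofReal ((σ + r k ^ 2) ^ (-(2 : ℝ))) := by
          rw [← ENNReal.ofReal_mul (by positivity), ← ENNReal.ofReal_mul (by positivity)]
          congr 1; ring
  calc ∫⁻ y in {y | a ≤ ‖y - x‖}, ‖oseenKernel σ (x - y) (v y) (v y)‖ₑ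
      ≤ ∫⁻ y in ⋃ k, A k, ‖oseenKernel σ (x - y) (v y) (v y)‖ₑ := lintegral_mono_set hcover
    _ ≤ ∑' k, ∫⁻ y in A k, ‖oseenKernel σ (x - y) (v y) (v y)‖ₑ := lintegral_iUnion_le _ _
    _ ≤ _ := ENNReal.tsum_le_tsum hshell

/-! ### The far-field bound -/

/-- **Far-field bound for the Oseen–Duhamel term from a Morrey bound** (`∫⁻` form). There is an
absolute constant `c > 0` (namely `4 C₀`, `C₀` the constant of the kernel bound (3.8)) such that
for all fields `M(τ, ·)` with `∫⁻_{B_r(x)} ‖M(τ, y)‖² dy ≤ I r` for `τ ∈ (s, t)`, `r > 0`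
(`I ≥ 0`), and every `a > 0`,
`‖∫_{(s,t)} ∫_{‖y-x‖ ≥ a} K(t-τ, x-y)[M(τ,y), M(τ,y)] dy dτ‖ ≤ c I / a`. No measurability of `M`
is needed (the iterated Bochner integral is bounded through `‖∫ f‖ₑ ≤ ∫⁻ ‖f‖ₑ`). Dyadic shells
(`lintegral_farField_enorm_oseenKernel_le`), `∫_{(s,t)} ((t-τ) + ρ)^{-2} ≤ ρ^{-1}`
(`setLIntegral_Ioo_sub_add_rpow_neg_two_le`) and `Σ_k 2^{-k} = 2`. [folklore] -/
theorem exists_norm_setIntegral_farField_oseenKernel_le :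
    ∃ c : ℝ, 0 < c ∧ ∀ {M : ℝ → EuclideanSpace ℝ (Fin 3) → EuclideanSpace ℝ (Fin 3)}
      {s t I a : ℝ} {x : EuclideanSpace ℝ (Fin 3)}, 0 ≤ I → 0 < a →
      (∀ τ ∈ Ioo s t, ∀ r > 0,
        ∫⁻ y in ball x r, ENNReal.ofReal (‖M τ y‖ ^ 2) ≤ ENNReal.ofReal (I * r)) →
      ‖∫ τ in Ioo s t, ∫ y in {y | a ≤ ‖y - x‖},
          oseenKernel (t - τ) (x - y) (M τ y) (M τ y)‖ ≤ c * I / a := by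
  obtain ⟨C₀, hC₀, hK⟩ := exists_norm_oseenKernel_three_le
  refine ⟨4 * C₀, by positivity, fun {M s t I a x} hI ha hMor => ?_⟩
  set r : ℕ → ℝ := fun k => a * 2 ^ k with hr
  have hr0 : ∀ k, 0 < r k := fun k => by positivity
  -- the shell terms as functions of the source time `τ`
  set g : ℕ → ℝ → ℝ≥0∞ := fun k τ => ENNReal.ofReal (C₀ * I * r (k + 1)) *
    ENNReal.ofReal (((t - τ) + r k ^ 2) ^ (-(2 : ℝ))) with hg
  have hgm : ∀ k, Measurable (g k) := fun k => by
    refine Measurable.const_mul (Measurable.ennreal_ofReal ?_) _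
    exact ((measurable_const.sub measurable_id).add_const _).pow_const _
  -- time integral of the `k`-th shell term: `≤ 2 C₀ I 2^{-k} / a`
  have hgk : ∀ k, ∫⁻ τ in Ioo s t, g k τ ≤ ENNReal.ofReal (2 * C₀ * I / a * (1 / 2) ^ k) := by
    intro k
    calc ∫⁻ τ in Ioo s t, g k τ
        = ENNReal.ofReal (C₀ * I * r (k + 1)) *
            ∫⁻ τ in Ioo s t, ENNReal.ofReal (((t - τ) + r k ^ 2) ^ (-(2 : ℝ))) :=
          lintegral_const_mul' _ _ ENNReal.ofReal_ne_top
      _ ≤ ENNReal.ofReal (C₀ * I * r (k + 1)) * ENNReal.ofReal (r k ^ 2)⁻¹ :=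
          mul_le_mul_right (setLIntegral_Ioo_sub_add_rpow_neg_two_le s t (by positivity)) _
      _ = ENNReal.ofReal (2 * C₀ * I / a * (1 / 2) ^ k) := by
          rw [← ENNReal.ofReal_mul (by positivity)]
          congr 1
          simp only [hr, one_div_pow, pow_succ]
          field_simp
  -- the shells sum to `4 C₀ I / a`
  have hsum : ∑' k, ∫⁻ τ in Ioo s t, g k τ ≤ ENNReal.ofReal (4 * C₀ * I / a) := by
    calc ∑' k, ∫⁻ τ in Ioo s t, g k τ
        ≤ ∑' k : ℕ, ENNReal.ofReal (2 * C₀ * I / a * (1 / 2) ^ k) := ENNReal.tsum_le_tsum hgk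
      _ = ENNReal.ofReal (∑' k : ℕ, 2 * C₀ * I / a * (1 / 2) ^ k) :=
          (ENNReal.ofReal_tsum_of_nonneg (fun k => by positivity)
            (summable_geometric_two.mul_left _)).symm
      _ = ENNReal.ofReal (4 * C₀ * I / a) := by
          rw [tsum_mul_left, tsum_geometric_two]; ring_nf
  -- the slice bound, for source times `τ ∈ (s, t)`
  have hslice : ∀ τ ∈ Ioo s t,
      ∫⁻ y in {y | a ≤ ‖y - x‖}, ‖oseenKernel (t - τ) (x - y) (M τ y) (M τ y)‖ₑ ≤ ∑' k, g k τ :=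
    fun τ hτ => lintegral_farField_enorm_oseenKernel_le hC₀.le hK (sub_pos.2 hτ.2) hI ha (hMor τ hτ)
  have hmain : ‖∫ τ in Ioo s t, ∫ y in {y | a ≤ ‖y - x‖},
      oseenKernel (t - τ) (x - y) (M τ y) (M τ y)‖ₑ ≤ ENNReal.ofReal (4 * C₀ * I / a) := by
    calc ‖∫ τ in Ioo s t, ∫ y in {y | a ≤ ‖y - x‖}, oseenKernel (t - τ) (x - y) (M τ y) (M τ y)‖ₑ
        ≤ ∫⁻ τ in Ioo s t, ‖∫ y in {y | a ≤ ‖y - x‖},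
            oseenKernel (t - τ) (x - y) (M τ y) (M τ y)‖ₑ := enorm_integral_le_lintegral_enorm _
      _ ≤ ∫⁻ τ in Ioo s t, ∫⁻ y in {y | a ≤ ‖y - x‖},
            ‖oseenKernel (t - τ) (x - y) (M τ y) (M τ y)‖ₑ :=
          lintegral_mono fun τ => enorm_integral_le_lintegral_enorm _
      _ ≤ ∫⁻ τ in Ioo s t, ∑' k, g k τ := setLIntegral_mono' measurableSet_Ioo hslice
      _ = ∑' k, ∫⁻ τ in Ioo s t, g k τ := lintegral_tsum fun k => (hgm k).aemeasurable
      _ ≤ ENNReal.ofReal (4 * C₀ * I / a) := hsum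
  rw [← ofReal_norm] at hmain
  exact (ENNReal.ofReal_le_ofReal_iff (by positivity)).1 hmain

/-- **Far-field bound for the Oseen–Duhamel term from a Morrey bound** (Bochner form). There is an
absolute constant `c > 0` such that for all fields `M(τ, ·)`, `τ ∈ (s, t)`, with `‖M(τ, ·)‖²`
integrable on the balls `B_r(x)` and `∫_{B_r(x)} ‖M(τ, y)‖² dy ≤ I r` (`r > 0`, `I ≥ 0`), and
every `a > 0`, `‖∫_{(s,t)} ∫_{‖y-x‖ ≥ a} K(t-τ, x-y)[M(τ,y), M(τ,y)] dy dτ‖ ≤ c I / a` — the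
far-field ("radiated from distance `≥ a`") part of the Duhamel term of a field with scale-invariant
Morrey control is `O(I / a)`, uniformly in the length of the time interval (the computation behind
the `C/|x|` decay (1.6) of KNSS 2009 for scale-invariant mild solutions). [folklore] -/
theorem exists_norm_setIntegral_farField_oseenKernel_le_of_integral :
    ∃ c : ℝ, 0 < c ∧ ∀ {M : ℝ → EuclideanSpace ℝ (Fin 3) → EuclideanSpace ℝ (Fin 3)}
      {s t I a : ℝ} {x : EuclideanSpace ℝ (Fin 3)}, 0 ≤ I → 0 < a →
      (∀ τ ∈ Ioo s t, ∀ r > 0, IntegrableOn (fun y => ‖M τ y‖ ^ 2) (ball x r)) →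
      (∀ τ ∈ Ioo s t, ∀ r > 0, ∫ y in ball x r, ‖M τ y‖ ^ 2 ≤ I * r) →
      ‖∫ τ in Ioo s t, ∫ y in {y | a ≤ ‖y - x‖},
          oseenKernel (t - τ) (x - y) (M τ y) (M τ y)‖ ≤ c * I / a := by
  obtain ⟨c, hc, h⟩ := exists_norm_setIntegral_farField_oseenKernel_le
  refine ⟨c, hc, fun {M s t I a x} hI ha hint hMor => h hI ha fun τ hτ r hr => ?_⟩
  rw [← ofReal_integral_eq_lintegral_ofReal (hint τ hτ r hr)
    (Eventually.of_forall fun y => by positivity)]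
  exact ENNReal.ofReal_le_ofReal (hMor τ hτ r hr)

end Literature.Analysis.FluidPDE
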